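import Summits.HodgeConjecture.CorCM.MumfordTateRankOfCMProductsHolds
import Literature.NumberTheory.ComplexMultiplication.AbelianCMFamilyOddSupport
import Literature.AlgebraicGeometry.Pohlmann1968.SeparatingCMFamilies
import HarnessLib

/-!
# Kubota's character formula on the MUMFORD–TATE GROUP of a product of CM abelian varieties with CM by subfields of an
# abelian number field: `dim MT(⊕_i H¹(A_i)) = 1 + #{odd characters of Gal(L/ℚ) seen by some factor}`

COR-CM (cell `pub-hodgecm2`, binder seat `b23` gen 29, lane KUBOTA-FAM G1), count-neutral; NEW as stated, hence under
`Summits/`.  Theorems only; no definition, no named fact, no `sorry`.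

The dictionary `dim MT(⊕_i H¹(A_i)) = cmFamilyRank Φ` for CM abelian varieties `A_i` realising `(K_i; Φ_i)` is the
tree theorem `mtRank_pi_bettiHodge_eq_cmFamilyRank_holds` (seat b27, Deligne 1982 I Ex. 3.7 (c) with every standing
hypothesis discharged), and `dim MT(H¹(A_i)) = cmTypeRank Φ_i` is `Motives.mtRank_bettiHodge_eq_cmTypeRank'`.  Read
through them, the Literature theorems of the KUBOTA-FAM lane (`AbelianCMFamilyRankCharacters`,
`AbelianCMFamilyNondegenerate`, `AbelianCMFamilyOddSupport`) become statements about Mumford–Tate groups.  Setting: CM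
fields `e_i : K_i ↪ L` inside ONE number field `L` which is an ABELIAN extension of `ℚ` (e.g. a cyclotomic field),
`ι : L → ℂ`, `ρ ∈ Gal(L/ℚ)` the complex conjugation, `S_i = {χ : χ(ρ) = −1, Σ_{g : ι∘g∘e_i ∈ Φ_i} χ(g) ≠ 0}` the odd
support of `Φ_i`, `n_χ = #{i : χ ∈ S_i}`:

* **`mtRank_pi_bettiHodge_eq_one_add_ncard_oddCharacters`** — `dim MT(⊕_i H¹(A_i)) = 1 + |⋃_i S_i|` (Kubota's Lemma 2
  / Gordon 9.4.1 for a PRODUCT: the rank of the Hodge group of `∏_i A_i` is the number of odd characters of `Gal(L/ℚ)`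
  seen by at least one factor);
* **`mtRank_pi_bettiHodge_add_card_add_sum_eq`** — `dim MT(⊕_i H¹(A_i)) + |I| + Σ_χ (n_χ − 1) = Σ_i dim MT(H¹(A_i)) + 1`:
  the defect of `Hg(∏_i A_i) ⊆ ∏_i Hg(A_i)` is the total excess multiplicity of the odd characters;
  **`mtRank_pi_bettiHodge_add_card_eq_iff_pairwise`** — `Hg(∏_i A_i) = ∏_i Hg(A_i)` iff no odd character is seen twice;
* **`exists_exceptional_prod_iff_exists_oddCharacter_trivial`** — for SIMPLE, pairwise NON-ISOGENOUS `A_i` with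
  NONDEGENERATE types: some `∏_i A_i^{k_i}` carries an exceptional Hodge class iff some odd character of `Gal(L/ℚ)` is
  trivial on `Gal(L/K_i)` and on `Gal(L/K_j)` for two factors `i ≠ j` (the field form — `K_i ∩ K_j` not totally real —
  is `AbelianCMFieldsHodge.exists_exceptional_prod_iff_of_abelian`).

## References

* [Kubota1965] T. Kubota, *On the field extension by complex multiplication*, Trans. AMS 118 (1965), §4 Lemma 2.
* [Gordon1999HodgeAVSurvey] B. B. Gordon, *A survey of the Hodge conjecture for abelian varieties*, §3 Theorem (Imai,
  Murty), 7.5–7.7, 9.1, 9.4.1.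
* [Deligne1982HodgeCycles] P. Deligne, *Hodge cycles on abelian varieties*, LNM 900 (1982), I Ex. 3.7 (c).
-/

noncomputable section

open scoped TensorProduct
open CategoryTheory CategoryTheory.Limits NumberField Module

namespace Summit.HodgeConjecture.CorCM

open Literature.NumberTheory.ComplexMultiplication
open Literature.AlgebraicGeometry.Motives
open Literature.AlgebraicGeometry.Motives.HodgeStructure
open Literature.AlgebraicGeometry.HodgeTheory
open Literature.AlgebraicGeometry.ComplexMultiplication (IsCMTypeRealisation)
open Literature.AlgebraicGeometry.Pohlmann1968
open Literature.Barriers.HodgeConjecture (divisorClassesSpan)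

variable {I : Type} [Fintype I] [DecidableEq I] [Nonempty I] {K : I → Type} [∀ i, Field (K i)]
  [∀ i, NumberField (K i)] [∀ i, IsCMField (K i)] {Φ : ∀ i, CMType (K i)}
  {A : I → AbelianVariety ℂ} {ι : ∀ i, 𝓞 (K i) →+* End (A i)}
  {θ : ∀ i, K i →+* Module.End ℂ (complexBetti (A i).X 1)}
variable {L : Type} [Field L] [NumberField L] [IsAbelianGalois ℚ L]

omit [∀ i, IsCMField (K i)] in
open scoped Classical in
/-- **Kubota's Lemma 2 on the Mumford–Tate group of a product.**  For CM abelian varieties `A_i` realising types `Φ_i` of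
CM subfields `e_i : K_i ↪ L` of an ABELIAN number field `L`:
`dim MT(⊕_i H¹(A_i)) = 1 + #{χ : Gal(L/ℚ) → ℂˣ | χ(ρ) = −1 ∧ ∃ i, Σ_{g : ι∘g∘e_i ∈ Φ_i} χ(g) ≠ 0}` — the rank of
`Hg(∏_i A_i)` is the number of odd characters seen by at least one factor. [cite: Kubota1965, §4 Lemma 2]
[cite: Gordon1999HodgeAVSurvey, 9.1 and 9.4.1] [cite: Deligne1982HodgeCycles, I Example 3.7 (c)] -/
theorem mtRank_pi_bettiHodge_eq_one_add_ncard_oddCharacters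
    (hA : ∀ i, IsCMTypeRealisation (Φ i) (A i) (ι i) (θ i)) (ιL : L →+* ℂ) (e : ∀ i, K i →+* L)
    (ρ : L ≃ₐ[ℚ] L) (hρ : ∀ x, ιL (ρ x) = starRingEnd ℂ (ιL x)) :
    haveI := hodgeTensorFacts_holds.{0, 0}
    haveI : ∀ i, Module.Finite ℚ (bettiCohomology (A i).X 1) := fun i => BettiUniverse.finite (hA i).1 1
    (HodgeStructure.pi fun i => BettiUniverse.hodge exists_isReal_hodgeModel_holds (hA i).1 1).mtRank =
      1 + {χ : AddChar (Additive (L ≃ₐ[ℚ] L)) ℂ | χ (Additive.ofMul ρ) = -1 ∧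
        ∃ i, ∑ g ∈ Finset.univ.filter (fun g : L ≃ₐ[ℚ] L => (ιL.comp (g : L →+* L)).comp (e i) ∈ (Φ i).1),
          χ (Additive.ofMul g) ≠ 0}.ncard := by
  haveI := hodgeTensorFacts_holds.{0, 0}
  exact (mtRank_pi_bettiHodge_eq_cmFamilyRank_holds hA).trans
    (cmFamilyRank_eq_one_add_ncard_oddCharacters ιL e ρ hρ Φ)

open scoped IsMulCommutative Classical in
/-- **The multiplicity formula on Mumford–Tate groups**: `dim MT(⊕_i H¹(A_i)) + |I| + Σ_χ (n_χ − 1) = Σ_i dim MT(H¹(A_i)) + 1`,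
`n_χ` the number of factors whose type sees the odd character `χ` — the defect of `Hg(∏_i A_i) ⊆ ∏_i Hg(A_i)` is the total
excess multiplicity of the odd characters of `Gal(L/ℚ)`. [cite: Kubota1965, §4 Lemma 2]
[cite: Gordon1999HodgeAVSurvey, §3 Theorem (proof) and 9.1] -/
theorem mtRank_pi_bettiHodge_add_card_add_sum_eq
    (hA : ∀ i, IsCMTypeRealisation (Φ i) (A i) (ι i) (θ i)) (ιL : L →+* ℂ) (e : ∀ i, K i →+* L)
    (ρ : L ≃ₐ[ℚ] L) (hρ : ∀ x, ιL (ρ x) = starRingEnd ℂ (ιL x)) :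
    haveI := hodgeTensorFacts_holds.{0, 0}
    haveI : ∀ i, Module.Finite ℚ (bettiCohomology (A i).X 1) := fun i => BettiUniverse.finite (hA i).1 1
    (HodgeStructure.pi fun i => BettiUniverse.hodge exists_isReal_hodgeModel_holds (hA i).1 1).mtRank +
        Fintype.card I +
        ∑ χ : AddChar (Additive (L ≃ₐ[ℚ] L)) ℂ,
          ((Finset.univ.filter fun i : I => χ (Additive.ofMul ρ) = -1 ∧
            ∑ g ∈ Finset.univ.filter (fun g : L ≃ₐ[ℚ] L => (ιL.comp (g : L →+* L)).comp (e i) ∈ (Φ i).1),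
              χ (Additive.ofMul g) ≠ 0).card - 1) =
      (∑ i, (BettiUniverse.hodge exists_isReal_hodgeModel_holds (hA i).1 1).mtRank) + 1 := by
  haveI := hodgeTensorFacts_holds.{0, 0}
  haveI : ∀ i, Module.Finite ℚ (bettiCohomology (A i).X 1) := fun i => BettiUniverse.finite (hA i).1 1
  rw [mtRank_pi_bettiHodge_eq_cmFamilyRank_holds hA]
  have h : ∀ i, (BettiUniverse.hodge exists_isReal_hodgeModel_holds (hA i).1 1).mtRank = cmTypeRank (Φ i) :=
    fun i => mtRank_bettiHodge_eq_cmTypeRank' (hA i) exists_isReal_hodgeModel_holds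
      hodgePQ_independent_of_hodgeModel_holds
  simp_rw [h]
  exact cmFamilyRank_add_card_add_sum_eq ιL e ρ hρ Φ

open scoped Classical in
/-- **`Hg(∏_i A_i) = ∏_i Hg(A_i)` iff no odd character is seen by two factors**:
`dim MT(⊕_i H¹(A_i)) + |I| = Σ_i dim MT(H¹(A_i)) + 1` iff for all `i ≠ j` no odd `χ` has both character sums non-zero.
[cite: Kubota1965, §4 Lemma 2] [cite: Gordon1999HodgeAVSurvey, §3 Theorem (proof) and 7.5] -/
theorem mtRank_pi_bettiHodge_add_card_eq_iff_pairwise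
    (hA : ∀ i, IsCMTypeRealisation (Φ i) (A i) (ι i) (θ i)) (ιL : L →+* ℂ) (e : ∀ i, K i →+* L)
    (ρ : L ≃ₐ[ℚ] L) (hρ : ∀ x, ιL (ρ x) = starRingEnd ℂ (ιL x)) :
    haveI := hodgeTensorFacts_holds.{0, 0}
    haveI : ∀ i, Module.Finite ℚ (bettiCohomology (A i).X 1) := fun i => BettiUniverse.finite (hA i).1 1
    (HodgeStructure.pi fun i => BettiUniverse.hodge exists_isReal_hodgeModel_holds (hA i).1 1).mtRank +
        Fintype.card I = (∑ i, (BettiUniverse.hodge exists_isReal_hodgeModel_holds (hA i).1 1).mtRank) + 1 ↔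
      ∀ χ : AddChar (Additive (L ≃ₐ[ℚ] L)) ℂ, χ (Additive.ofMul ρ) = -1 → ∀ i j : I, i ≠ j →
        ¬(∑ g ∈ Finset.univ.filter (fun g : L ≃ₐ[ℚ] L => (ιL.comp (g : L →+* L)).comp (e i) ∈ (Φ i).1),
              χ (Additive.ofMul g) ≠ 0 ∧
          ∑ g ∈ Finset.univ.filter (fun g : L ≃ₐ[ℚ] L => (ιL.comp (g : L →+* L)).comp (e j) ∈ (Φ j).1),
              χ (Additive.ofMul g) ≠ 0) := by
  haveI := hodgeTensorFacts_holds.{0, 0}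
  haveI : ∀ i, Module.Finite ℚ (bettiCohomology (A i).X 1) := fun i => BettiUniverse.finite (hA i).1 1
  rw [mtRank_pi_bettiHodge_eq_cmFamilyRank_holds hA]
  have h : ∀ i, (BettiUniverse.hodge exists_isReal_hodgeModel_holds (hA i).1 1).mtRank = cmTypeRank (Φ i) :=
    fun i => mtRank_bettiHodge_eq_cmTypeRank' (hA i) exists_isReal_hodgeModel_holds
      hodgePQ_independent_of_hodgeModel_holds
  simp_rw [h]
  exact cmFamilyRank_add_card_eq_iff_pairwise ιL e ρ hρ Φ

omit [DecidableEq I] in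
/-- **Exceptional Hodge classes ⟺ a shared odd character (Galois form).**  For SIMPLE, pairwise NON-ISOGENOUS CM abelian
varieties `A_i` with NONDEGENERATE types of CM subfields `K_i ↪ L` of an abelian number field `L`: some product
`∏_i A_i^{k_i}` carries an exceptional Hodge class (rational, of type `(m,m)`, outside `Dᵐ ⊗ ℂ`) iff some odd character of
`Gal(L/ℚ)` is trivial on both `Gal(L/K_i) = {h | h ∘ e_i = e_i}` and `Gal(L/K_j)` for two factors `i ≠ j`.
[cite: Gordon1999HodgeAVSurvey, 7.5–7.7] [cite: Kubota1965, §4 Lemma 2] -/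
theorem exists_exceptional_prod_iff_exists_oddCharacter_trivial
    (hA : ∀ i, IsCMTypeRealisation (Φ i) (A i) (ι i) (θ i)) (hS : ∀ i, (A i).IsSimple)
    (hniso : ∀ i j, i ≠ j → ¬ AbelianVariety.IsIsogenous (A i) (A j)) (hnd : ∀ i, IsNondegenerate (Φ i))
    (ιL : L →+* ℂ) (e : ∀ i, K i →+* L) (ρ : L ≃ₐ[ℚ] L) (hρ : ∀ x, ιL (ρ x) = starRingEnd ℂ (ιL x)) :
    (∃ (N : ℕ) (π : Fin N → I) (m : ℕ) (c : complexBetti (⨁ fun j : Fin N => A (π j)).X (2 * m)),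
        IsRationalClass c ∧
        IsOfHodgeType (⨁ fun j : Fin N => A (π j)).dim (⨁ fun j : Fin N => A (π j)).X (2 * m) m m c ∧
        c ∉ divisorClassesSpan (⨁ fun j : Fin N => A (π j)).X (⨁ fun j : Fin N => A (π j)).dim m) ↔
      ∃ χ : AddChar (Additive (L ≃ₐ[ℚ] L)) ℂ, χ (Additive.ofMul ρ) = -1 ∧ ∃ i j : I, i ≠ j ∧
        (∀ h : L ≃ₐ[ℚ] L, (∀ x, h (e i x) = e i x) → χ (Additive.ofMul h) = 1) ∧
        ∀ h : L ≃ₐ[ℚ] L, (∀ x, h (e j x) = e j x) → χ (Additive.ofMul h) = 1 := by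
  have hsep := CMAlgebra.isSeparatingFamily_of_isSimple_of_pairwise_not_isIsogenous hA hS hniso
  have hcrit := isNondegenerateFamily_iff_pairwise_of_forall_isNondegenerate ιL e ρ hρ Φ hnd
  constructor
  · rintro ⟨N, π, m, c, hcQ, hcH, hcD⟩
    have hdeg : ¬ CMAlgebra.IsNondegenerateFamily Φ := fun h =>
      h.not_exists_exceptional_prod hA π m ⟨c, hcQ, hcH, hcD⟩
    rw [hcrit] at hdeg
    push Not at hdeg
    obtain ⟨χ, hχ, i, j, hij, hi, hj⟩ := hdeg
    exact ⟨χ, hχ, i, j, hij, hi, hj⟩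
  · rintro ⟨χ, hχ, i, j, hij, hi, hj⟩
    refine CMAlgebra.exists_exceptional_prod_of_not_isNondegenerateFamily hsep (fun h => ?_) hA
    exact (hcrit.1 h) χ hχ i j hij ⟨hi, hj⟩

end Summit.HodgeConjecture.CorCM

end
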